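import Summits.QuantumFields.BalabanUV.Beta.EriceFlowEnclosureB12AsPrintedHistoryContagionShiftFlowZeroTwoLoopPin
import Summits.QuantumFields.BalabanUV.Beta.EriceFlowEnclosureB12AsPrintedHistoryContagionShiftFlowZeroEnd

/-!
# Beta / EriceFlowEnclosureB12AsPrintedHistoryContagionShiftFlowZeroTwoLoopEnd — ASYMPTOTIC FREEDOM IS CONTAGIOUS, part 41 (the two-loop END): ON THE AS-PRINTED CARRIER, THEOREM
# 2 AS TYPED + NE4 + THE TWO-LOOP LETTER WITH MEMORY FOR THE LIMIT FUNCTIONAL GIVE EVERY CONTINUUM TRAJECTORY OF «g₀(ε, g)» THE TWO-LOOP LAW WITH AN ABSOLUTE Λ, AND Λ IS AN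
# RG-INVARIANT COORDINATE ON THEM.  Parts 39–40 read on the carrier of [I] Theorem 2.  From `Theorem2Statement S hL` (a HYPOTHESIS) + `hrg` on ]0, γ_u] + NE4
# `ScaleShiftRate c θ γ_u S.β` + `HistLipschitz Λ γ_u S.β` with `FadingMemory C θ Λ` (0 < θ < 1) + THE TWO-LOOP LETTER WITH MEMORY (T2m) FOR `betaInf S.β` with constant β₀ = its
# value at the zero history and some b₁, C₂ (a displayed binder — NOT PRINTED for Bałaban's functional): for every torus exponent m, below one threshold g₂₅, EVERY family `rows`
# of Theorem-2-type rows pinned at g has **`1∕gstar rows m′² − m′·β₀ − (b₁∕β₀)·log m′ → Λ(rows)`** — THE TWO-LOOP LAW OF THE CONTINUUM RUNNING COUPLING WITH AN ABSOLUTE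
# Λ-PARAMETER, `1∕g_{m′}² = m′β₀ + (b₁∕β₀) log m′ + Λ + o(1)` — with the read-outs `1∕(m′ gstar²) → β₀`, `(1∕gstar² − m′β₀)∕log m′ → b₁∕β₀` (**`twoLoop_of_typedTheorem2`**); and
# on every ]0, g′] with g′ ≤ g₂₆ the absolute Λ is a FUNCTION `Λ₂` of the renormalized coupling (no reference family) — bi-Lipschitz in 1∕g², strictly decreasing, continuous, ONTO
# [Λ₂ g′, ∞[ with unique couplings — satisfying THE ABEL EQUATION **`Λ₂ (gstar rows k) = Λ₂ g + k·β₀`** along every family (**`twoLoopLambdaFunction_of_typedTheorem2`**): the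
# renormalized coupling g of [I] Theorem 2 and the two-loop Λ-parameter of its continuum trajectory determine each other, and the renormalization group acts on Λ by translation
# by β₀ — Erice's (3.76) «1∕g₀² = 1∕g² − β₀ log_L ε^{−1} − β₁ log_L log_L ε^{−1} + O(1)» READ IN THE CONTINUUM for the flow with memory, with its O(1) a CONVERGENT coordinate.
# (β-flow team, prover 1, unit `b2b-balaban-beta-bflow-p1`, gen 39; ROW AP-I·Uc × ROW Λ × ROW E10 — the two-loop END on the carrier)

HONEST FRAMING (page 1 of everything the β sub-cell writes): discharging `BetaPertH` makes Bałaban's UV stability UNCONDITIONAL — a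
real constructive-QFT result; it is NOT the continuum limit and NOT the Clay problem.  HONEST DEPENDENCY (cell reorg 2026-08-19,
verbatim): «continuum YM on T⁴ ⇐ BetaPertH ∧ nine spine estimates (0/9 proved); BetaPertH ⇐ (D1) ∧ (D4) ∧ CAP+tail; G-an2-4 gates
asym, D1 and NE2/3/4.»  THIS MODULE DISCHARGES NOTHING: it is BOOKKEEPING BY NAME (parts 32, 39, 40; part 15's `reference_of_typedTheorem2`; part 36's
`package_threshold_exists`; part 10's `invSq_lower_of_reference_flow`; node U2's `memoryProfile_betaInf`; d4-p2's (E54d) read-outs) over node U2's HYPOTHESIS SHAPES on an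
abstract `S : Setting`.  `Theorem2Statement S hL` ([I] THEOREM 2 p. 259, STATED WITHOUT PROOF; [Balaban1989LargeFieldII] p. 355), `hrg` ((0.20) p. 256), NE4 (GAPS G-t4-U2-1, p. 298),
the moduli (GAPS G-t4-U2-2) AND (T2m) for `betaInf S.β` are HYPOTHESES — none asserted for Bałaban's actual β; Erice's (3.73)∕(3.76) (p. 250) concern the LATTICE functions of ONE
coupling and the BARE end; the continuum two-loop law here is OUR READING of them for the limit functional with memory, NOT PRINTED.  «continuum running coupling» = the K → ∞
limit of the effective couplings of (0.20) at fixed physical scale (`T4ContinuumCoupling.gstar`), NOT the continuum limit of the measures.  [I] = T. Bałaban, Commun. Math. Phys.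
**109** (1987) 249–301 [Balaban1987RG1].

WHAT THIS FILE PROVES (0 sorry, 0 def): §65 **`twoLoop_of_typedTheorem2`**, **`twoLoopLambdaFunction_of_typedTheorem2`**.  NOT CLAIMED: Theorem 2; (T2m) for Bałaban's functional;
the values of β₀, b₁; `BetaPertH`; the continuum limit of the measures; Clay.
-/

namespace Summit.QuantumFields.BalabanUV.Beta.EriceFlowEnclosureB12AsPrintedHistoryContagionShiftFlowZeroTwoLoopEnd

open Finset Filter Topology Set
open Literature.MathematicalPhysics.QuantumFieldTheory.Balaban1983to89
open Literature.MathematicalPhysics.QuantumFieldTheory.Balaban1983to89.B12BetaAsPrinted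
open Literature.MathematicalPhysics.QuantumFieldTheory.Balaban1983to89.FlowStep (RGEqH)
open Literature.MathematicalPhysics.QuantumFieldTheory.Balaban1983to89.T4CouplingMatching (HistLipschitz FadingMemory ScaleShiftRate)
open Literature.MathematicalPhysics.QuantumFieldTheory.Balaban1983to89.T4ContinuumCoupling (gstar)
open Literature.MathematicalPhysics.QuantumFieldTheory.Balaban1983to89.T4BetaStationary (SeqBox MemoryProfile betaInf memoryProfile_betaInf)
open Literature.MathematicalPhysics.QuantumFieldTheory.Balaban1983to89.T4BetaFlowWellPosed (MemFlow)
open Summit.QuantumFields.BalabanUV.Beta.EriceFlowEnclosureB12AsPrintedHistoryContagionShiftFlow (invSq_lower_of_reference_flow)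
open Summit.QuantumFields.BalabanUV.Beta.EriceFlowEnclosureB12AsPrintedHistoryContagionShiftFlowPicardEnd (reference_of_typedTheorem2)
open Summit.QuantumFields.BalabanUV.Beta.EriceFlowEnclosureB12AsPrintedHistoryContagionShiftFlowZero (exists_valueAtZero rate_le_valueAtZero)
open Summit.QuantumFields.BalabanUV.Beta.EriceFlowEnclosureB12AsPrintedHistoryContagionShiftFlowZeroEnd (package_threshold_exists)
open Summit.QuantumFields.BalabanUV.Beta.EriceFlowEnclosureB12AsPrintedHistoryContagionShiftFlowZeroTwoLoop (exists_twoLoopLambda twoLoop_readouts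
  twoLoop_const_eq_valueAtZero)
open Summit.QuantumFields.BalabanUV.Beta.EriceFlowEnclosureB12AsPrintedHistoryContagionShiftFlowZeroTwoLoopPin (twoLoopLambda_tail twoLoopLambdaFunction_exists)

noncomputable section

/-! ## §65 Theorem 2 AS TYPED + the two-loop letter with memory for the limit functional -/

variable {S : Setting}

/-- **THE TWO-LOOP LAW OF THE CONTINUUM RUNNING COUPLING WITH AN ABSOLUTE Λ — FROM THEOREM 2 AS TYPED AND THE TWO-LOOP LETTER WITH MEMORY.**  `Theorem2Statement S hL` (a
HYPOTHESIS), `hrg`, NE4 + moduli (0 < θ < 1, C ≥ 0, c ≥ 0), and the two-loop letter with memory (T2m) for `betaInf S.β` with constants (b₀, b₁, C₂):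
`|betaInf S.β u − b₀ − b₁u(0)²| ≤ C₂·Σθ^j(u(j)⁴ + |u(j)² − u(0)²|)` on ]0, γ_u]^ℕ.  THEN b₀ IS the value β₀ > 0 of `betaInf S.β` at the zero history, and for every torus exponent m there
is g₂₅ > 0 such that EVERY family `rows` of Theorem-2-type rows in ]0, γ_u] pinned at g ≤ g₂₅ satisfies: **`1∕gstar rows m′² − m′·b₀ − (b₁∕b₀)·log m′ → Λ`** for some Λ (the
ABSOLUTE two-loop Λ-parameter of the continuum trajectory), the tails' two-loop sequences tend to `Λ + k·b₀`, and the read-outs `1∕(m′·gstar rows m′²) → b₀`,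
`(1∕gstar rows m′² − m′b₀)∕log m′ → b₁∕b₀` hold. [cite: Balaban1987RG1, Thm 2 (0.31) p.259 with (0.20) p.256 and §5 p.298] -/
theorem twoLoop_of_typedTheorem2 {hL : Odd S.L ∧ 1 < S.L} (h : Theorem2Statement S hL)
    {γu θ C c b₀ b₁ C₂ : ℝ} {Λ : ℕ → ℕ → ℝ} (hγu : 0 < γu)
    (hrg : ∀ P : B12.RunParams, Step.InInterval γu P.K (S.cpl P) → RGEqH P.K S.β (S.cpl P))
    (hS : ScaleShiftRate c θ γu S.β) (hL' : HistLipschitz Λ γu S.β) (hΛ : FadingMemory C θ Λ)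
    (hθ0 : 0 < θ) (hθ1 : θ < 1) (hC : 0 ≤ C) (hc : 0 ≤ c) (hC₂ : 0 ≤ C₂)
    (h2 : ∀ u : ℕ → ℝ, SeqBox γu u → |betaInf S.β u - b₀ - b₁ * u 0 ^ 2| ≤ C₂ * ∑' j, θ ^ j * (u j ^ 4 + |u j ^ 2 - u 0 ^ 2|)) (m : ℕ) :
    0 < b₀ ∧ (∀ u : ℕ → ℝ, SeqBox γu u → |betaInf S.β u - b₀| ≤ C * ∑' j, θ ^ j * u j) ∧
    ∃ g₂₅ : ℝ, 0 < g₂₅ ∧ ∀ (g : ℝ) (rows : ℕ → ℕ → ℝ), 0 < g → g ≤ g₂₅ →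
      (∀ K, ∃ (m' : ℕ) (g₀ : ℝ), rows K = S.cpl ⟨K, m', g₀⟩) → (∀ K, Step.InInterval γu K (rows K)) → (∀ K, rows K K = g) →
      ∃ Λt : ℝ, Tendsto (fun m' : ℕ => 1 / (gstar rows m') ^ 2 - (m' : ℝ) * b₀ - b₁ / b₀ * Real.log (m' : ℝ)) atTop (𝓝 Λt) ∧
        (∀ k : ℕ, Tendsto (fun m' : ℕ => 1 / (gstar rows (k + m')) ^ 2 - (m' : ℝ) * b₀ - b₁ / b₀ * Real.log (m' : ℝ)) atTop (𝓝 (Λt + (k : ℝ) * b₀))) ∧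
        Tendsto (fun m' : ℕ => 1 / ((m' : ℝ) * (gstar rows m') ^ 2)) atTop (𝓝 b₀) ∧
        Tendsto (fun m' : ℕ => (1 / (gstar rows m') ^ 2 - (m' : ℝ) * b₀) / Real.log (m' : ℝ)) atTop (𝓝 (b₁ / b₀)) := by
  have h1θ : 0 < 1 - θ := by linarith
  have hB := memoryProfile_betaInf hS hL' hΛ hθ0.le hθ1
  obtain ⟨β₀, h0⟩ := exists_valueAtZero hB hC hθ0.le hθ1 hγu
  have hb₀ : b₀ = β₀ := twoLoop_const_eq_valueAtZero hθ0.le hθ1 hγu h0 h2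
  subst hb₀
  obtain ⟨gr, b, g₂, -, t, hgr, hb, hg₂, -, htbox, htflow, hprof, hmem, -⟩ :=
    reference_of_typedTheorem2 h hγu hrg hS hL' hΛ hθ0 hθ1 hC hc m
  have h2gr : 0 < 2 * gr := by positivity
  have hβ₀ : 0 < b₀ := hb.trans_le (rate_le_valueAtZero hC hθ0.le hθ1 hb h2gr h0 htbox htflow hprof)
  obtain ⟨e₀, he₀, hthr⟩ := package_threshold_exists (1 / gr ^ 2 + C * γu / (1 - θ) ^ 2 + (2 * C / ((1 - θ) * b)) ^ 2) hC hθ1 hb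
  refine ⟨hβ₀, h0, min e₀ g₂, lt_min he₀ hg₂, fun g rows hg hle hrow hI hpin => ?_⟩
  obtain ⟨hs1, hs2, -, -⟩ := hthr g hg (hle.trans (min_le_left _ _))
  obtain ⟨hbox, hflow⟩ := hmem rows g hrow hI hpin (hle.trans (min_le_right _ _))
  have hprofg : ∀ m' : ℕ, 1 / (2 * g) ^ 2 + b / 4 * (m' : ℝ) ≤ 1 / (gstar rows m') ^ 2 := fun m' => by
    have := invSq_lower_of_reference_flow hB hC hθ0.le hθ1 hb h2gr htbox htflow hprof hbox hflow hs1 hs2 m'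
    rwa [show (1 : ℝ) / (2 * g) ^ 2 = 1 / (4 * g ^ 2) by ring]
  have hb4 : 0 < b / 4 := by positivity
  have h2g : 0 < 2 * g := by positivity
  obtain ⟨Λt, hΛt⟩ := exists_twoLoopLambda hC hθ0.le hθ1 hC₂ hb4 h2g h0 h2 hbox hflow hprofg
  obtain ⟨hr1, hr2⟩ := twoLoop_readouts hC hθ0.le hθ1 hC₂ hb4 h2g h0 h2 hbox hflow hprofg
  exact ⟨Λt, hΛt, fun k => twoLoopLambda_tail hΛt k, hr1, hr2⟩

/-- **THE TWO-LOOP Λ-PARAMETER OF THE CONTINUUM TRAJECTORIES IS AN RG-INVARIANT COORDINATE — FROM THEOREM 2 AS TYPED AND THE TWO-LOOP LETTER WITH MEMORY.**  Under the data of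
`twoLoop_of_typedTheorem2`, for every torus exponent m there is g₂₆ > 0 such that for EVERY g′ ∈ ]0, g₂₆] (no reference family needed — the Λ is absolute) there is
`Λ₂ : ℝ → ℝ` with `StrictAntiOn Λ₂ ]0, g′]`, `ContinuousOn Λ₂ ]0, g′]`, **`(2∕3)(1∕g₁² − 1∕g₂²) ≤ Λ₂ g₁ − Λ₂ g₂ ≤ (4∕3)(1∕g₁² − 1∕g₂²)`**, Λ₂ ONTO [Λ₂ g′, ∞[ with unique
couplings, and for EVERY family `rows` pinned at `g ∈ ]0, g′]`: **`1∕gstar rows m′² − m′b₀ − (b₁∕b₀) log m′ → Λ₂ g`** and THE ABEL EQUATION **`Λ₂ (gstar rows k) = Λ₂ g + k·b₀`**.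
[cite: Balaban1987RG1, Thm 2 (0.31) p.259 with (0.20) p.256 and §5 p.298] -/
theorem twoLoopLambdaFunction_of_typedTheorem2 {hL : Odd S.L ∧ 1 < S.L} (h : Theorem2Statement S hL)
    {γu θ C c b₀ b₁ C₂ : ℝ} {Λ : ℕ → ℕ → ℝ} (hγu : 0 < γu)
    (hrg : ∀ P : B12.RunParams, Step.InInterval γu P.K (S.cpl P) → RGEqH P.K S.β (S.cpl P))
    (hS : ScaleShiftRate c θ γu S.β) (hL' : HistLipschitz Λ γu S.β) (hΛ : FadingMemory C θ Λ)
    (hθ0 : 0 < θ) (hθ1 : θ < 1) (hC : 0 ≤ C) (hc : 0 ≤ c) (hC₂ : 0 ≤ C₂)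
    (h2 : ∀ u : ℕ → ℝ, SeqBox γu u → |betaInf S.β u - b₀ - b₁ * u 0 ^ 2| ≤ C₂ * ∑' j, θ ^ j * (u j ^ 4 + |u j ^ 2 - u 0 ^ 2|)) (m : ℕ) :
    ∃ g₂₆ : ℝ, 0 < g₂₆ ∧ ∀ g' : ℝ, 0 < g' → g' ≤ g₂₆ →
      ∃ Λ₂ : ℝ → ℝ, StrictAntiOn Λ₂ (Ioc 0 g') ∧ ContinuousOn Λ₂ (Ioc 0 g') ∧
        (∀ g₁ ∈ Ioc 0 g', ∀ g₂ ∈ Ioc 0 g', g₁ ≤ g₂ →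
          2 / 3 * (1 / g₁ ^ 2 - 1 / g₂ ^ 2) ≤ Λ₂ g₁ - Λ₂ g₂ ∧ Λ₂ g₁ - Λ₂ g₂ ≤ 4 / 3 * (1 / g₁ ^ 2 - 1 / g₂ ^ 2)) ∧
        (∀ y : ℝ, Λ₂ g' ≤ y → ∃! e : ℝ, e ∈ Ioc 0 g' ∧ Λ₂ e = y) ∧
        ∀ (g : ℝ) (rows : ℕ → ℕ → ℝ), 0 < g → g ≤ g' →
          (∀ K, ∃ (m' : ℕ) (g₀ : ℝ), rows K = S.cpl ⟨K, m', g₀⟩) → (∀ K, Step.InInterval γu K (rows K)) → (∀ K, rows K K = g) →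
          Tendsto (fun m' : ℕ => 1 / (gstar rows m') ^ 2 - (m' : ℝ) * b₀ - b₁ / b₀ * Real.log (m' : ℝ)) atTop (𝓝 (Λ₂ g)) ∧
          ∀ k : ℕ, Λ₂ (gstar rows k) = Λ₂ g + (k : ℝ) * b₀ := by
  have h1θ : 0 < 1 - θ := by linarith
  have hB := memoryProfile_betaInf hS hL' hΛ hθ0.le hθ1
  obtain ⟨β₀, h0⟩ := exists_valueAtZero hB hC hθ0.le hθ1 hγu
  have hb₀ : b₀ = β₀ := twoLoop_const_eq_valueAtZero hθ0.le hθ1 hγu h0 h2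
  subst hb₀
  obtain ⟨gr, b, g₂, -, t, hgr, hb, hg₂, -, htbox, htflow, hprof, hmem, -⟩ :=
    reference_of_typedTheorem2 h hγu hrg hS hL' hΛ hθ0 hθ1 hC hc m
  have h2gr : 0 < 2 * gr := by positivity
  obtain ⟨e₀, he₀, hthr⟩ := package_threshold_exists (1 / gr ^ 2 + C * γu / (1 - θ) ^ 2 + (2 * C / ((1 - θ) * b)) ^ 2) hC hθ1 hb
  refine ⟨min e₀ (min g₂ (γu / 2)), lt_min he₀ (lt_min hg₂ (by positivity)), fun g' hg' hle => ?_⟩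
  obtain ⟨hs1, hs2, hs4, hs5⟩ := hthr g' hg' (hle.trans (min_le_left _ _))
  have hle2' : g' ≤ g₂ := hle.trans ((min_le_right _ _).trans (min_le_left _ _))
  have h2g' : 2 * g' ≤ γu := by linarith [hle.trans ((min_le_right _ _).trans (min_le_right _ _))]
  obtain ⟨Λ₂, hΛh, hbounds, hanti, hcont, habel, hsurj⟩ :=
    twoLoopLambdaFunction_exists hB hC hθ0.le hθ1 hC₂ hb h2gr h0 h2 htbox htflow hprof hg' h2g' hs1 hs2 hs4 hs5
  refine ⟨Λ₂, hanti, hcont, hbounds, hsurj, fun g rows hg hgg' hrow hI hpin => ?_⟩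
  obtain ⟨hbox, hflow⟩ := hmem rows g hrow hI hpin (hgg'.trans hle2')
  exact ⟨hΛh g ⟨hg, hgg'⟩ _ hbox hflow, habel g ⟨hg, hgg'⟩ _ hbox hflow⟩

end

end Summit.QuantumFields.BalabanUV.Beta.EriceFlowEnclosureB12AsPrintedHistoryContagionShiftFlowZeroTwoLoopEnd
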